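import Summits.RiemannHypothesis.RiemannHypothesis.Theorems.DBNKernelHolomorphy
import Mathlib.Analysis.Complex.PhragmenLindelof
import HarnessLib

/-!
# RiemannHypothesis / DBN — T1a `BoundaryReduction` (and T1a-ε) by Phragmén–Lindelöf on the strip

RH-FREE (THEORY-R1 §2 target T1a; proof route THEORY-R3 §6 of the `pub-dbn` cell).  Proved here,
sorry-free, standard axioms:

* `abs_probeKernel_le`, `descentKernelEps_nonneg` : a priori bounds on the closed strip `|η| ≤ 1`;
* `BoundaryReductionEps_holds` (T1a-ε): `k ≤ P_ε + δ` on the lines `η = ±1` implies the same on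
  the closed strip — Mathlib's `PhragmenLindelof.horizontal_strip` applied to
  `g = exp(Σ wᵢ Kᵢ - Π_ε - δ)`, holomorphic on a neighbourhood of the closed strip
  (`DBNKernelHolomorphy.lean`), bounded there, of modulus `exp(k - P_ε - δ) ≤ 1` on the boundary;
* `four_div_le_descentKernelEps_one` (boundary comparison L1): `4/(ξ²+4) ≤ P_ε(ξ,1)`, `0 < ε ≤ 2`;
* `BoundaryReduction_holds` (T1a): for `1 < cᵢ`, `0 ≤ κᵢ`,
  `Admissible1D w c κ u ↔ Admissible2D w c κ u` — (⇒) evenness in `η`, L1, T1a-ε with `δ = 0`,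
  and `P_ε → P` (`ε → 0⁺`) off the corners; (⇐) the corner value `k(0,1) ≤ 1` by continuity of
  `k(·,1)`;
* `sum_weights_le_one_of_admissible2D` (T1a + T1c): hypothesis (K) forces net weight `Σ wᵢ ≤ 1`.

Consequence for the column (THEORY-R1 §2): the 2-D box certification of hypothesis (K) of the
2001 descent lemma (1.2·10⁸ boxes) is equivalent to a 1-D inequality on `η = 1` (the archived
Region IV, `η ∈ [1, 1.02]`, lies outside the strip and is a separate check).
`--supports stmt-RiemannHypothesis-0274`; nothing here bears on the truth of RH.
-/

noncomputable section

-- D-0017: `Summit.<S>.<S>.…` is the designed namespace of a single-problem summit.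
set_option linter.dupNamespace false

open scoped Real
open MeasureTheory Set intervalIntegral

namespace Summit.RiemannHypothesis.RiemannHypothesis.Theorems.DbnTheory

/-! ## A priori bounds on the closed strip `|η| ≤ 1` -/

/-- `|S_{c,κ,u}(ξ,η)| ≤ (2/(c-1))·|1 - (-1)|` for `|η| ≤ 1 < c` (each Poisson term is `≤ 1/(c-1)`,
`φ ≤ 1`). [folklore] -/
theorem abs_probeKernel_le (c κ u ξ η : ℝ) (hc : 1 < c) (hη : |η| ≤ 1) :
    |probeKernel c κ u ξ η| ≤ 2 / (c - 1) * |(1:ℝ) - -1| := by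
  unfold probeKernel
  rw [← Real.norm_eq_abs]
  refine intervalIntegral.norm_integral_le_of_norm_le_const fun v _ => ?_
  obtain ⟨hη1, hη2⟩ := abs_le.mp hη
  have h1 : 0 < c - η := by linarith
  have h2 : 0 < c + η := by linarith
  have hc1 : 0 < c - 1 := by linarith
  have hb0 := biweight_nonneg v
  have hb1 := biweight_le v
  rw [Real.norm_eq_abs, abs_of_nonneg (by positivity)]
  have hA : (c - η) / ((c - η)^2 + (ξ - u - κ * v)^2) ≤ 1 / (c - 1) := by
    rw [div_le_div_iff₀ (by positivity) hc1]
    nlinarith [sq_nonneg (ξ - u - κ * v), mul_nonneg h1.le (by linarith : (0:ℝ) ≤ 1 - η)]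
  have hB : (c + η) / ((c + η)^2 + (ξ - u - κ * v)^2) ≤ 1 / (c - 1) := by
    rw [div_le_div_iff₀ (by positivity) hc1]
    nlinarith [sq_nonneg (ξ - u - κ * v), mul_nonneg h2.le (by linarith : (0:ℝ) ≤ 1 + η)]
  calc biweight v * ((c - η) / ((c - η)^2 + (ξ - u - κ * v)^2) + (c + η) / ((c + η)^2 + (ξ - u - κ * v)^2))
      ≤ 1 * (1 / (c - 1) + 1 / (c - 1)) :=
        mul_le_mul (by linarith) (add_le_add hA hB) (by positivity) zero_le_one
    _ = 2 / (c - 1) := by ring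

/-- `P_ε ≥ 0` on the closed strip `|η| ≤ 1` (`ε ≥ 0`). [folklore] -/
theorem descentKernelEps_nonneg (ε ξ η : ℝ) (hε : 0 ≤ ε) (hη : |η| ≤ 1) : 0 ≤ descentKernelEps ε ξ η := by
  obtain ⟨hη1, hη2⟩ := abs_le.mp hη
  have h1 : 0 ≤ 1 + ε - η := by linarith
  have h2 : 0 ≤ 1 + ε + η := by linarith
  unfold descentKernelEps
  positivity

/-! ## T1a-ε: Phragmén–Lindelöf on the strip -/

/-- **`BoundaryReductionEps`** (T1a-ε, THEORY-R3 §6): if `k ≤ P_ε + δ` on the lines `η = ±1` then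
`k ≤ P_ε + δ` on the closed strip `|η| ≤ 1`.  Proof: `g = exp(K - Π_ε - δ)` is holomorphic on a
neighbourhood of the closed strip (`K`, `Π_ε` the holomorphic functions with `Re K = k`,
`Re Π_ε = P_ε`), bounded there (`|k| ≤ Σ|wᵢ|·4/(cᵢ-1)`, `P_ε ≥ 0`), and `‖g‖ ≤ 1` on the two
boundary lines; Mathlib's `PhragmenLindelof.horizontal_strip` gives `‖g‖ ≤ 1` inside. [folklore] -/
theorem BoundaryReductionEps_holds : BoundaryReductionEps := by
  intro n w c κ u ε δ hc _ hε h1 h2 ξ η hη1 hη2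
  -- the holomorphic function `g = exp (Σ wᵢ Kᵢ - Π_ε - δ)`
  set G : ℂ → ℂ := fun z => Complex.exp (∑ i, (w i : ℂ) * (∫ v in (-1:ℝ)..1, ((biweight v : ℝ) : ℂ) *
      (((c i : ℂ) + Complex.I * (z - u i - κ i * v))⁻¹ + ((c i : ℂ) - Complex.I * (z - u i - κ i * v))⁻¹))
      - 2 * ((((1 + ε : ℝ) : ℂ) + Complex.I * z)⁻¹ + (((1 + ε : ℝ) : ℂ) - Complex.I * z)⁻¹) - (δ : ℂ))
    with hG
  -- its modulus on the closed strip
  have hnorm : ∀ z : ℂ, |z.im| ≤ 1 →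
      ‖G z‖ = Real.exp (signedKernel w c κ u z.re z.im - descentKernelEps ε z.re z.im - δ) := by
    intro z hz
    rw [hG]
    dsimp only
    rw [Complex.norm_exp, Complex.sub_re, Complex.sub_re, Complex.ofReal_re, Complex.re_sum,
      re_descentC]
    have hS : ∑ i, ((w i : ℂ) * (∫ v in (-1:ℝ)..1, ((biweight v : ℝ) : ℂ) *
        (((c i : ℂ) + Complex.I * (z - u i - κ i * v))⁻¹ + ((c i : ℂ) - Complex.I * (z - u i - κ i * v))⁻¹))).re
        = signedKernel w c κ u z.re z.im := by
      unfold signedKernel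
      refine Finset.sum_congr rfl fun i _ => ?_
      rw [Complex.re_ofReal_mul, re_integral_probeC (c i) (κ i) (u i) z (lt_of_le_of_lt hz (hc i))]
    rw [hS]
  -- holomorphy on a neighbourhood of the closed strip
  have hdiff : ∀ z : ℂ, |z.im| < 1 + ε → (∀ i, |z.im| < c i) → DifferentiableAt ℂ G z := by
    intro z hz1 hz2
    rw [hG]
    refine DifferentiableAt.cexp ?_
    refine ((DifferentiableAt.fun_sum fun i _ => ?_).fun_sub (differentiableAt_descentC ε hz1)).sub_const _
    exact (differentiableAt_integral_probeC (c i) (κ i) (u i) (hz2 i)).const_mul _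
  -- a priori bound on the closed strip
  have hM : ∀ z : ℂ, |z.im| ≤ 1 →
      ‖G z‖ ≤ Real.exp (∑ i, |w i| * (2 / (c i - 1) * |(1:ℝ) - -1|) - δ) := by
    intro z hz
    rw [hnorm z hz, Real.exp_le_exp]
    have hP : 0 ≤ descentKernelEps ε z.re z.im := descentKernelEps_nonneg ε z.re z.im hε.le hz
    have hk : signedKernel w c κ u z.re z.im ≤ ∑ i, |w i| * (2 / (c i - 1) * |(1:ℝ) - -1|) := by
      unfold signedKernel
      refine Finset.sum_le_sum fun i _ => ?_
      have hb := abs_probeKernel_le (c i) (κ i) (u i) z.re z.im (hc i) hz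
      calc w i * probeKernel (c i) (κ i) (u i) z.re z.im
          ≤ |w i * probeKernel (c i) (κ i) (u i) z.re z.im| := le_abs_self _
        _ = |w i| * |probeKernel (c i) (κ i) (u i) z.re z.im| := abs_mul _ _
        _ ≤ |w i| * (2 / (c i - 1) * |(1:ℝ) - -1|) := mul_le_mul_of_nonneg_left hb (abs_nonneg _)
    linarith
  -- Phragmén–Lindelöf on the strip `-1 < Im z < 1`
  have hPL := PhragmenLindelof.horizontal_strip (a := -1) (b := 1) (C := 1) (f := G) (z := ⟨ξ, η⟩)
    ?_ ?_ ?_ ?_ (by simpa using hη1) (by simpa using hη2)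
  · rw [hnorm ⟨ξ, η⟩ (abs_le.mpr ⟨hη1, hη2⟩), Real.exp_le_one_iff] at hPL
    change signedKernel w c κ u ξ η - descentKernelEps ε ξ η - δ ≤ 0 at hPL
    linarith
  · -- `DiffContOnCl`
    refine ⟨fun z hz => (hdiff z ?_ fun i => ?_).differentiableWithinAt, fun z hz => ?_⟩
    · have h := abs_lt.mpr hz; linarith
    · have h := abs_lt.mpr hz; linarith [hc i]
    · have hz' : z ∈ Complex.im ⁻¹' Icc (-1:ℝ) 1 :=
        closure_minimal (preimage_mono Ioo_subset_Icc_self) (isClosed_Icc.preimage Complex.continuous_im) hz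
      have habs : |z.im| ≤ 1 := abs_le.mpr hz'
      exact (hdiff z (by linarith) fun i => by linarith [hc i]).continuousAt.continuousWithinAt
  · -- growth: `G` is bounded on the strip
    refine ⟨0, ?_, 0, Asymptotics.IsBigO.of_bound (Real.exp (∑ i, |w i| * (2 / (c i - 1) * |(1:ℝ) - -1|) - δ)) ?_⟩
    · rw [show (1:ℝ) - -1 = 2 by norm_num]; positivity
    · refine Filter.eventually_inf_principal.mpr (Filter.Eventually.of_forall fun z hz => ?_)
      have h : |z.im| ≤ 1 := (abs_lt.mpr hz).le
      simpa using hM z h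
  · intro z hz
    rw [hnorm z (by rw [hz]; norm_num), Real.exp_le_one_iff, hz]
    linarith [h2 z.re]
  · intro z hz
    rw [hnorm z (by rw [hz]; norm_num), Real.exp_le_one_iff, hz]
    linarith [h1 z.re]


/-! ## T1a: the boundary reduction (`ε → 0`) -/

/-- `S` is even in `η`. [folklore] -/
theorem probeKernel_neg (c κ u ξ η : ℝ) : probeKernel c κ u ξ (-η) = probeKernel c κ u ξ η := by
  unfold probeKernel
  refine intervalIntegral.integral_congr fun v _ => ?_
  ring

/-- `k` is even in `η`. [folklore] -/
theorem signedKernel_neg {n : ℕ} (w c κ u : Fin n → ℝ) (ξ η : ℝ) :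
    signedKernel w c κ u ξ (-η) = signedKernel w c κ u ξ η := by
  unfold signedKernel
  simp_rw [probeKernel_neg]

/-- `P_ε` is even in `η`. [folklore] -/
theorem descentKernelEps_neg (ε ξ η : ℝ) : descentKernelEps ε ξ (-η) = descentKernelEps ε ξ η := by
  unfold descentKernelEps
  ring

/-- `P_0 = P`. [folklore] -/
theorem descentKernelEps_zero (ξ η : ℝ) : descentKernelEps 0 ξ η = descentKernel ξ η := by
  unfold descentKernelEps descentKernel
  simp

/-- `P(ξ,1) = 4/(ξ²+4)` (for `ξ = 0` by the junk value `0/0 = 0`). [folklore] -/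
theorem descentKernel_one (ξ : ℝ) : descentKernel ξ 1 = 4 / (ξ^2 + 4) := by
  unfold descentKernel
  ring

/-- **Boundary comparison (L1 of THEORY-R3 §6)**: `P(ξ,1) = 4/(ξ²+4) ≤ P_ε(ξ,1)` for `0 < ε ≤ 2`
and every `ξ` (including the corner `ξ = 0`). [folklore] -/
theorem four_div_le_descentKernelEps_one (ε ξ : ℝ) (hε : 0 < ε) (hε2 : ε ≤ 2) :
    4 / (ξ^2 + 4) ≤ descentKernelEps ε ξ 1 := by
  unfold descentKernelEps
  rw [show (1:ℝ) + ε - 1 = ε by ring, show (1:ℝ) + ε + 1 = 2 + ε by ring]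
  have hξ := sq_nonneg ξ
  have hA : 0 < ξ^2 + ε^2 := by positivity
  have hB : 0 < ξ^2 + (2 + ε)^2 := by positivity
  have hC : 0 < ξ^2 + 4 := by positivity
  rw [div_add_div _ _ hA.ne' hB.ne', ← mul_div_assoc, div_le_div_iff₀ hC (mul_pos hA hB)]
  have h3 : ε^3 ≤ 8 := by nlinarith [pow_le_pow_left₀ hε.le hε2 3]
  nlinarith [mul_nonneg hξ hε.le, mul_nonneg (mul_nonneg hξ hξ) hε.le, mul_nonneg hξ (sq_nonneg ε),
    mul_nonneg (mul_nonneg hξ (sq_nonneg ε)) hε.le, sq_nonneg ε, mul_pos hε hε]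

/-- Continuity of `ξ ↦ k(ξ,η)` for `|η| < min cᵢ`. [folklore] -/
theorem continuous_signedKernel {n : ℕ} (w c κ u : Fin n → ℝ) (η : ℝ) (hη : ∀ i, |η| < c i) :
    Continuous fun ξ : ℝ => signedKernel w c κ u ξ η := by
  unfold signedKernel
  exact continuous_finsetSum _ fun i _ => continuous_const.mul (continuous_probeKernel (c i) (κ i) (u i) η (hη i))

/-- `P_ε(ξ,η) → P(ξ,η)` as `ε → 0` at every point of the strip other than the corners `(0,±1)`. [folklore] -/
theorem tendsto_descentKernelEps (ξ η : ℝ) (h1 : ξ^2 + (1 - η)^2 ≠ 0) (h2 : ξ^2 + (1 + η)^2 ≠ 0) :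
    Filter.Tendsto (fun ε : ℝ => descentKernelEps ε ξ η) (nhds 0) (nhds (descentKernel ξ η)) := by
  have hc1 : ContinuousAt (fun ε : ℝ => (1 + ε - η) / (ξ^2 + (1 + ε - η)^2)) 0 :=
    (by fun_prop : Continuous fun ε : ℝ => 1 + ε - η).continuousAt.div
      (by fun_prop : Continuous fun ε : ℝ => ξ^2 + (1 + ε - η)^2).continuousAt (by simpa using h1)
  have hc2 : ContinuousAt (fun ε : ℝ => (1 + ε + η) / (ξ^2 + (1 + ε + η)^2)) 0 :=
    (by fun_prop : Continuous fun ε : ℝ => 1 + ε + η).continuousAt.div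
      (by fun_prop : Continuous fun ε : ℝ => ξ^2 + (1 + ε + η)^2).continuousAt (by simpa using h2)
  have hc : ContinuousAt (fun ε : ℝ => descentKernelEps ε ξ η) 0 := by
    unfold descentKernelEps
    exact continuousAt_const.mul (hc1.add hc2)
  have := hc.tendsto
  rwa [descentKernelEps_zero] at this

/-- **`BoundaryReduction`** (T1a, THEORY-R1 §2): for probes above the top zero (`1 < cᵢ`) the 2-D
kernel hypothesis (K) of the descent lemma on `ℝ × [0,1] ∖ {(0,1)}` is EQUIVALENT to the 1-D
inequality `k(ξ,1) ≤ 4/(ξ²+4)`.  (⇒): `k(·,±1) ≤ 4/(ξ²+4) ≤ P_ε(·,±1)` for `0 < ε ≤ 2` (boundary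
comparison + evenness), so `k ≤ P_ε` on the closed strip by T1a-ε, and `P_ε → P` off the corners.
(⇐): `η = 1`, `ξ ≠ 0` is the hypothesis, and the corner value `k(0,1) ≤ 1` follows by continuity of
`k(·,1)`. [folklore] -/
theorem BoundaryReduction_holds : BoundaryReduction := by
  intro n w c κ u hc hκ
  constructor
  · intro h1D ξ η hη0 hη1 hne
    have hk : ∀ ε : ℝ, 0 < ε → ε ≤ 2 → signedKernel w c κ u ξ η ≤ descentKernelEps ε ξ η := by
      intro ε hε hε2
      have hb1 : ∀ ξ' : ℝ, signedKernel w c κ u ξ' 1 ≤ descentKernelEps ε ξ' 1 + 0 := fun ξ' => by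
        rw [add_zero]; exact (h1D ξ').trans (four_div_le_descentKernelEps_one ε ξ' hε hε2)
      have hb2 : ∀ ξ' : ℝ, signedKernel w c κ u ξ' (-1) ≤ descentKernelEps ε ξ' (-1) + 0 := fun ξ' => by
        rw [signedKernel_neg, descentKernelEps_neg]; exact hb1 ξ'
      have h := BoundaryReductionEps_holds n w c κ u ε 0 hc hκ hε hb1 hb2 ξ η (by linarith) hη1
      linarith
    have hd1 : ξ^2 + (1 - η)^2 ≠ 0 := by
      intro h0
      have hξ2 : ξ^2 = 0 := by nlinarith [sq_nonneg ξ, sq_nonneg (1 - η)]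
      have hη2 : (1 - η)^2 = 0 := by nlinarith [sq_nonneg ξ, sq_nonneg (1 - η)]
      have hξ : ξ = 0 := pow_eq_zero_iff (two_ne_zero) |>.mp hξ2
      have hη' : η = 1 := by have := pow_eq_zero_iff (two_ne_zero) |>.mp hη2; linarith
      exact hne (by rw [hξ, hη'])
    have hd2 : ξ^2 + (1 + η)^2 ≠ 0 := by positivity
    refine ge_of_tendsto ((tendsto_descentKernelEps ξ η hd1 hd2).mono_left (nhdsWithin_le_nhds (s := Ioi 0))) ?_
    exact Filter.eventually_of_mem (Ioc_mem_nhdsGT (show (0:ℝ) < 2 by norm_num))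
      fun ε hε => hk ε hε.1 hε.2
  · intro h2D ξ
    by_cases hξ : ξ = 0
    · -- the corner: continuity of `k(·,1)` and `4/(ξ²+4)` at `ξ = 0`
      subst hξ
      have hcont : Continuous fun ξ : ℝ => 4 / (ξ^2 + 4) - signedKernel w c κ u ξ 1 := by
        refine Continuous.sub ?_ (continuous_signedKernel w c κ u 1 fun i => by
          rw [abs_one]; exact hc i)
        exact continuous_const.div (by fun_prop) fun ξ => by positivity
      have hlim := (hcont.tendsto 0).mono_left (nhdsWithin_le_nhds (s := {(0:ℝ)}ᶜ))
      have hev : ∀ᶠ ξ in nhdsWithin (0:ℝ) {(0:ℝ)}ᶜ, 0 ≤ 4 / (ξ^2 + 4) - signedKernel w c κ u ξ 1 := by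
        refine eventually_nhdsWithin_of_forall fun ξ hξ => ?_
        have h := h2D ξ 1 zero_le_one le_rfl (by simpa using hξ)
        rw [descentKernel_one] at h
        linarith
      have h0 := ge_of_tendsto hlim hev
      linarith
    · have h := h2D ξ 1 zero_le_one le_rfl (by simpa using hξ)
      rwa [descentKernel_one] at h

/-- **Corollary (T1a + T1c)**: any signed probe family satisfying hypothesis (K) of the 2001 descent
lemma (`Admissible2D`, probes above the top zero, non-negative smears) has net weight `Σ wᵢ ≤ 1` —
the `W ≤ 1` wall of the probe class (THEORY-R1 §1–§3). [folklore] -/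
theorem sum_weights_le_one_of_admissible2D {n : ℕ} (w c κ u : Fin n → ℝ) (hc : ∀ i, 1 < c i)
    (hκ : ∀ i, 0 ≤ κ i) (h : Admissible2D w c κ u) : ∑ i, w i ≤ 1 :=
  NetWeightCeiling_holds n w c κ u hc hκ ((BoundaryReduction_holds n w c κ u hc hκ).mpr h)

end Summit.RiemannHypothesis.RiemannHypothesis.Theorems.DbnTheory

end
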